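import Mathlib
import Summits.PneNP.PneNP.Theses.Nc03AvoidResidualCore
import Summits.PneNP.PneNP.Theorems.Nc03AvoidResidualCoreReductionAssemblyFP

/-!
# Route Nc03AvoidResidualCore, item `ResidualCoreReduction` — the residual-core reduction, proved

Closing file for `stmt-PneNP-20227` (cell pnp-ideate, route `Nc03AvoidResidualCore`, rung F-N1b):
**if pure-`CAND` range avoidance at linear stretch is in FP, then all of `NC⁰₃-AVOID` at linear
stretch is in FP** (`Summit.PneNP.PneNP.Theses.Nc03AvoidResidualCore.ResidualCoreReduction`).

The proof is the composition of the helper files `…Reduction*`: parse the input code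
(`…Parse`); compute the NPN class of every output and choose a class whose bucket is large
(`…Assembly`); relax the bucket to a pure instance on `6n` variable copies (`…Frame`, `…NPN`,
`…Glue`); solve it — classes `0,1,2,4,5` by tuple searches (`…SolveA/B`), the linear classes
`3,7,8,9,10,11` by rank computations over `𝔽₂` (`…RankKit`, `…SolveC/D/E`), `MAJ₃` and `MUX` by the
rigidity certificates found by BFS, greedy cycle packing and one fundamental-cycle flip (`…Bfs*`,
`…Bal`, `…Fcyc*`, `…Pack`, `…Flip`, `…MajB/C`, `…MuxA/B`, programs `…BfsP1–5`, `…Solve6/12`), and the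
`CAND` class by the hypothesised oracle (`…Cand`); put the negations back and scatter (`…Glue`).
Everything is one `CodeFP` program (`codeFP_solver`), hence one `IsPolyTime` string function; with
the oracle's constant `C₀` the reduction works at stretch `m ≥ (6 C₀ + 150) n` (`outBits_correct`).
-/

set_option linter.dupNamespace false -- `Summit.PneNP.PneNP.…`: summit = sub-problem name (D-0017 single-conjunct layout)

namespace Summit.PneNP.PneNP.Theorems

open Literature.Computability.Complexity Nc03Reduction

/-- **The residual-core reduction** (`stmt-PneNP-20227`): `CAND`-avoidance at linear stretch in FP
implies `NC⁰₃`-avoidance at linear stretch in FP. -/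
theorem residualCoreReduction_proof : Summit.PneNP.PneNP.Theses.Nc03AvoidResidualCore.ResidualCoreReduction := by
  unfold Theses.Nc03AvoidResidualCore.ResidualCoreReduction Theses.Nc03AvoidResidualCore.CandAvoidLinearFP
    LocalAvoidLinearFP
  rintro ⟨C₀, f₀, hf₀, hspec⟩
  obtain ⟨F, hF, hFspec⟩ := codeFP_solver (f₀ := f₀) hf₀
  refine ⟨6 * C₀ + 150, F, (CookBridges.isPolyTime_iff F).2 hF, fun n m I _ hn hm => ?_⟩
  have hout := outBits_correct I (f₀ := f₀) (C₀ := C₀) (fun N M J hP hN hM => hspec N M J hP hN hM) hn hm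
  have e : readOut m (F I.encode) = fun j : Fin m => (outBits f₀ (toRaw ⟨n, m, I⟩)).getD j.val false := by
    funext j
    unfold readOut
    rw [show I.encode = eIn ⟨n, m, I⟩ from rfl, hFspec]
    rfl
  rw [e]
  exact hout

end Summit.PneNP.PneNP.Theorems
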